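import Summits.QuantumFields.BalabanUV.Beta.D1BFx.PackedColumnBlockPairTotalMass
import Summits.QuantumFields.BalabanUV.Beta.D1BFx.PackedStraightColumn

/-!
# `BalabanUV.Beta.D1BFx.PackedStraightColumnMass` — road «BF-x» for binder row D1, slot (K), PART 24 letter «M-pack» AT THE CHART OF RECORD (α′), FILE B of «K0-PACK»:
# **THE (M-b) PACKED ROWS AT THE STRAIGHT COLUMN `colH (KInvStep 3 n 0) n` WITH THE POWERS DISPLAYED — ONE STRAIGHT COLUMN PAYS EXACTLY `n⁻⁵`, TWO PAY `n⁻¹⁰`;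
# THE TABLE's BLOCK(-PAIR) TOTALS ENTER WITH WHATEVER POWER THE TABLE AUTHOR CERTIFIES** — UNCONDITIONAL

HONEST DEPENDENCY (cell records, verbatim): «continuum YM on T⁴ ⇐ BetaPertH ∧ nine spine estimates (0/9 proved); BetaPertH ⇐ (D1) ∧ (D4) ∧
CAP+tail; G-an2-4 gates asym, D1 and NE2/3/4.»  HONEST FRAMING (cell contract, verbatim): «discharging `BetaPertH` makes Bałaban's UV stability
UNCONDITIONAL — a real constructive-QFT result; it is NOT the continuum limit and NOT the Clay problem.»  THIS MODULE DISCHARGES NOTHING of the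
wall: [folklore] `ℓ¹` bookkeeping BY NAME over LANDED objects (FILE A `PackedStraightColumn` §1–§2, this lineage's FILE 4 `PackedColumnBlockPairTotalMass` §3 — the
K-generic `mass_blk_vertex2OfK_le_of_blockPairTotal`).  No definition, no `def … : Prop`, nothing cited, 0 sorry.  Every table letter is a DISPLAYED hypothesis
on an ARBITRARY family — nothing of an1's ∕ an3's tables or of Bałaban's is asserted; NO (1.22) row is proved; 0 root-level binders of row D1 discharged (hW ∕ hR-
sockets ∕ hSX-socket ∕ D1Tel ∕ D1Rep = 0); (J1) ONE OPEN ROW; (K) NOT closed; NOT D1, NEVER «G-an2-4 closed», NOT `BetaPertH`, NOT continuum, NOT Clay.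

ABSOLUTE RULE (cell charter, verbatim): «No internally-minted statement may enter as a cited fact. Every hypothesis is either kernel-proved in
this package or a verbatim quotation of a PUBLISHED theorem with page reference. The manuscript(s) under audit are NOT citable for their own
disputed steps — they are the thing under adjudication; programme-internal (2001/route/tribunal) claims are never citable.»

WHY.  Under (α′) (row OWNER an2 R-D1-g44-2; road OWNER d1-p2 g23 `COLUMN-GAUGE-INSTANCE-SPEC-g23.md` v0.1, (W2-fine) (i)) the priced words are packed with the STRAIGHT
one-shot column: `V^{smooth} = vertexOfK (KInvStep n 0) n S⁰`, and the `vertex2OfK` part of `W^{smooth}` carries it on BOTH slots.  PART24-SPEC-g23 §2 «M-pack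
(exists modulo units): packed vertex ∕ pair-vertex block masses WITH the unit displayed (`≤ n³·m̄V`, `≤ n²·m̄W`)»; the road's R-T
`RestKernelSandwichScaled.exists_row_RkSand_tadpole_unit` (p351880 ✓) consumes the pair letter as the HYPOTHESIS `hWm : Σ' |ffW (𝒲 (m+1)) μ 0 ν z| ≤ ((m+1):ℝ)^2·mW·
e^{−κ|z|₁}` («whether the pair letter holds WITH POWER 2 and k-free `m̄W` … is the SUPPLIER's letter (gan24-leaf-05 … with the unit displayed)»).  At the straight
column the kernel's share of that power is EXACT: FILE A §2 `abs_colH_K₀_road_le` (`n⁻⁵` per column, unconditional).  This file re-reads this lineage's FILE 2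
(single vertex, through FILE A §1) and FILE 4 §2 (pair, BY NAME) at that column and DISPLAYS the powers: the single-vertex row loses exactly ONE power of `n` against
FILE 2's block-total currency `n⁴·m̄S` (§3), the pair row loses exactly `n^{10}` against the block-pair total `T` (§4) — a table author's count `T = n^{12}·m̄W` then
reads as R-T's power `2`, a count in FILE 4 ∕ 5's `n⁸·m̄B` currency as power `−2`.  What stays displayed is ONLY the table author's block(-pair) count (d1-leaf-01
`RawStencilSupportRows` ∕ `RawPairStencilSupportRows`, an1 ∕ an3 letters), which this file does NOT supply.

CONTENT (`d = 3`, any block side `n` with `[NeZero n]` — the road's `Lc^k` included —, `K₀ := KInvStep 3 n 0`, `C₄ := MG163 4·periodConst (kappa163 4) 3`, `κ′ := kappa163 4 ∕ 4`).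
* §3 SINGLE VERTEX at `K₀`: **`mass_blk_vertexOfK_K₀_le_of_blockTotal`** (FILE 2 `mass_blk_vertexOfK_G₀_le_of_blockTotal`'s currency `hSB ≤ n⁴·m̄S j k` VERBATIM — FILE 5
  `hSB_of_hSm` and FILE 6's scales adapters feed it unchanged — ⟹ `≤ n⁻¹·(4·C₄·e^{κ′}·e^{κ′∕2}·Zl 4 (κ′∕8))·m̄S j k`, ONE power below FILE 2's dressed row),
  **`mass_blk_vertexOfK_K₀_le_pow`** (`hSB ≤ n^{p+5}·m̄ j k` ⟹ `≤ n^p·(…)·m̄ j k`, any `p : ℕ`).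
* §4 PAIR at `K₀` (FILE 4 §2 `mass_nested_wsum_le_of_blockPairTotal` + `RestTableBlockMass.blk_vertex2OfK` BY NAME): the per-block core **`mass_blk_vertex2OfK_K₀_le`**
  (ONE block `(j, i)`: block-pair totals `≤ T·e^{−θ|y₂ − y₁|₁}` ⟹ the `(j, i)` block of `vertex2OfK (KInvStep 3 n 0) n S₂ μ y ν y′` has summable plain mass
  `≤ (n^{10})⁻¹·(16·(C₄e^{κ′})²·e^{2κ′}·Zl 4 (κ′∕8)·Zl 4 (θ∕2))·T·e^{−min (κ′∕8) (θ∕2)|y′ − y|₁}`), **`mass_blk_vertex2OfK_K₀_le_of_blockPairTotal`** (FILE 4 §4's all-blocks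
  hypothesis shape `T j i`),
  **`mass_blk_vertex2OfK_K₀_le_pow`** (`T j i := n^{p+10}·m̄W j i` ⟹ power `n^p`; at `p = 2`, `(μ, 0; ν, z)` the shape of R-T's `hWm` for
  `𝒲 n := vertex2OfK (KInvStep 3 n 0) n (S₂ n)` read on its `(j, i)` block, `κ := min (κ′∕8) (θ∕2)` — MODULO the table author's count),
  **`mass_blk_vertex2OfK_K₀_le_of_blockPairTotal₈`** (FILE 4 ∕ 5's `n⁸·m̄B` currency — `PackedColumnBlockTotalOfPerSlot.hTB_of_hBm` — ⟹ power `(n²)⁻¹`, TWO below FILE 4 §4's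
  dressed row).
* §5 R-T's letter LITERALLY: **`ffW_vertex2OfK_K₀_rows_pow`** — for a per-scale pair pack `S₂ n` with tt block-pair totals `≤ n^{p+10}·m̄W·e^{−θ|y₂ − y₁|₁}` (displayed),
  `∀ m z`, `Summable (q ↦ Σ_{g f} |ffW (vertex2OfK (KInvStep 3 (m+1) 0) (m+1) (S₂ (m+1))) μ 0 ν z q g f|)` and the `tsum ≤ ((m+1):ℝ)^p·(C_{K₀,2}(θ)·m̄W)·e^{−(min (κ′∕8) (θ∕2))·|z|₁}`
  (`PackedKernelSplit.ffW_apply`, `smul_zero`, `sub_zero`) — at `p = 2` the `hWs ∕ hWm` pair of `exists_row_RkSand_tadpole_unit` for `𝒲 := fun n => vertex2OfK (KInvStep 3 n 0) n (S₂ n)`.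
NOT HERE (honest): any count of any table; any (1.22) row; the `mixOfK` ∕ `dM∘K2OfK` parts of `W^{smooth}` (colM-weighted — the (M-a) ∕ (L1-M) letters); the gauge words
(cancelled by `hessKer_columnGauge_of_relInv`, not priced); the cross-word cancellation an2 R-D1-g45-1 (3) reads at `n = 3` (absolute-value letters cannot see it).
Unit `b2b-balaban-gan24-formalise-leaf-05` (gen 60), G-an2-4 swarm leaf prover 05, road «BF-x» supplier; INTENT-1 «K0-PACK» FILE B (journal [GAN24LEAF05-G60-INTENT-1] ∕ A-1).
-/

noncomputable section

open Finset
open scoped BigOperators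
open Literature.MathematicalPhysics.QuantumFieldTheory
open Literature.MathematicalPhysics.QuantumFieldTheory.Balaban1983to89
open Literature.MathematicalPhysics.QuantumFieldTheory.Balaban1983to89.Beta
open B12Sec2to5 (l1 l1_nonneg)
open B5Hk163Strip (kappa163 kappa163_pos)
open B5Hk163Decay (MG163)
open B4TorusKernel (periodConst)
open ExpKernelCalculus (Site MKer Zl Zl_pos Zl_nonneg)
open AffineAveraging (box toSite)
open OneStepResolventKernel (Fib wsum)
open OneStepKernelFamily (colH KInvStep vertexOfK)
open SecondOrderResponse (vertex2OfK)
open Summit.QuantumFields.BalabanUV.Beta.D1BFx.PackedKernelSplit (blk ffW ffW_apply)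
open Summit.QuantumFields.BalabanUV.Beta.D1BFx.RestTableBlockMass (blk_vertex2OfK)
open Summit.QuantumFields.BalabanUV.Beta.D1BFx.PackedColumnBlockPairTotalMass (mass_nested_wsum_le_of_blockPairTotal)
open Summit.QuantumFields.BalabanUV.Beta.D1BFx.PackedStraightColumn (mass_blk_vertexOfK_le_of_blockTotal abs_colH_K₀_road_le colH_K₀_road_weight_nonneg)

namespace Summit.QuantumFields.BalabanUV.Beta.D1BFx.PackedStraightColumnMass

/-! ## §3 The SINGLE VERTEX at the straight column: FILE 2's block-total currency, the power `n⁻¹` displayed -/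

section Single

/-- [folklore] **«K0-JET-MASS» — THE (M-b) PACKED-VERTEX ROW AT THE STRAIGHT COLUMN, POWER DISPLAYED** (UNCONDITIONAL): for `0 ≤ σ ≤ κ′∕(16n)` and a first-jet pack `S`
(fibre `Fib 3`) whose blocks have summable per-slot `u`-centred weighted masses and BLOCK-TOTAL letters `Σ_{b ∈ box 4 n} (…) ≤ n⁴·m̄S j k` (FILE 2
`PackedColumnBlockTotalMass.mass_blk_vertexOfK_G₀_le_of_blockTotal`'s currency VERBATIM — FILE 5 `hSB_of_hSm` and FILE 6's scales adapters feed it unchanged), every block of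
`vertexOfK (KInvStep 3 n 0) n S μ y` has centred weighted mass at `n•y`, rate `σ`, summable and `≤ n⁻¹·(4·C₄·e^{κ′}·e^{κ′∕2}·Zl 4 (κ′∕8))·m̄S j k` — ONE POWER OF `n` BELOW
the bm-dressed row of FILE 2 (`4·C_{G₀}·e^{κ′∕2}·Zl 4 (κ′∕8)·m̄S j k`, power `n⁰`): the straight column pays `n⁻⁵` against the `n⁴` slots of a block. -/
theorem mass_blk_vertexOfK_K₀_le_of_blockTotal (n : ℕ) [NeZero n] {S : Fin (3 + 1) → (Fin (3 + 1) → ℤ) → MKer 4 (Fib 3)} {σ : ℝ} {mS : Bool → Bool → ℝ}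
    (hσ0 : 0 ≤ σ) (hσ : σ ≤ kappa163 4 / 4 / (16 * (n : ℝ)))
    (hSs : ∀ κ u j k, Summable fun p : Site 4 × Site 4 =>
      ∑ g, ∑ f, |blk (S κ u) j k p.1 p.2 g f| * Real.exp (σ * (l1 (p.1 - u) + l1 (p.2 - u))))
    (hSB : ∀ (κ : Fin (3 + 1)) (y' : Fin (3 + 1) → ℤ) (j k : Bool), ∑ b ∈ box (3 + 1) n,
      (∑' p : Site 4 × Site 4, ∑ g, ∑ f, |blk (S κ ((n : ℤ) • y' + toSite b)) j k p.1 p.2 g f|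
        * Real.exp (σ * (l1 (p.1 - ((n : ℤ) • y' + toSite b)) + l1 (p.2 - ((n : ℤ) • y' + toSite b)))))
      ≤ (n : ℝ) ^ 4 * mS j k)
    (μ : Fin (3 + 1)) (y : Fin (3 + 1) → ℤ) (j k : Bool) :
    (Summable fun p : Site 4 × Site 4 => ∑ g, ∑ f,
        |blk (vertexOfK (KInvStep (d := 3) n 0) n S μ y) j k p.1 p.2 g f|
          * Real.exp (σ * (l1 (p.1 - (n : ℤ) • y) + l1 (p.2 - (n : ℤ) • y)))) ∧
      ∑' p : Site 4 × Site 4, ∑ g, ∑ f,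
          |blk (vertexOfK (KInvStep (d := 3) n 0) n S μ y) j k p.1 p.2 g f|
            * Real.exp (σ * (l1 (p.1 - (n : ℤ) • y) + l1 (p.2 - (n : ℤ) • y)))
        ≤ (n : ℝ)⁻¹ * (4 * ((MG163 4 * periodConst (kappa163 4) 3) * Real.exp (kappa163 4 / 4))
            * Real.exp (kappa163 4 / 4 / 2) * Zl 4 (kappa163 4 / 4 / 8)) * mS j k := by
  have hn0 : (0 : ℝ) < (n : ℝ) := by exact_mod_cast Nat.pos_of_ne_zero (NeZero.ne n)
  set aa : ℝ := kappa163 4 / 4 / (4 * (n : ℝ)) with haa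
  have hκ : 0 < kappa163 4 := kappa163_pos 4
  have haa0 : 0 < aa := by positivity
  have hσ' : σ ≤ aa / 4 := by
    refine hσ.trans (le_of_eq ?_)
    rw [haa]; field_simp; ring
  obtain ⟨hs, hb⟩ := mass_blk_vertexOfK_le_of_blockTotal (KInvStep (d := 3) n 0) n
    (T := fun j k => (n : ℝ) ^ 4 * mS j k) haa0 (colH_K₀_road_weight_nonneg n) hσ0 hσ' μ y
    (fun κ u => abs_colH_K₀_road_le n μ y κ u) hSs hSB j k
  refine ⟨hs, hb.trans (le_of_eq ?_)⟩
  have e1 : 2 * aa * (n : ℝ) = kappa163 4 / 4 / 2 := by rw [haa]; field_simp; ring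
  have e2 : aa * (n : ℝ) / 2 = kappa163 4 / 4 / 8 := by rw [haa]; field_simp; ring
  rw [e1, e2]
  have hn5 : ((n : ℝ)) ^ 5 ≠ 0 := by positivity
  have hn : ((n : ℝ)) ≠ 0 := hn0.ne'
  field_simp

/-- [folklore] **THE SAME ROW, THE TABLE's POWER FREE**: block-total letters `≤ n^{p+5}·m̄ j k` (any `p : ℕ` — the table author's count, the literal's `cE` included) give
every block of `vertexOfK (KInvStep 3 n 0) n S μ y` centred weighted mass `≤ n^p·(4·C₄·e^{κ′}·e^{κ′∕2}·Zl 4 (κ′∕8))·m̄ j k` — the straight column pays exactly `n⁻⁵`. -/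
theorem mass_blk_vertexOfK_K₀_le_pow (n : ℕ) [NeZero n] (p : ℕ) {S : Fin (3 + 1) → (Fin (3 + 1) → ℤ) → MKer 4 (Fib 3)} {σ : ℝ} {mS : Bool → Bool → ℝ}
    (hσ0 : 0 ≤ σ) (hσ : σ ≤ kappa163 4 / 4 / (16 * (n : ℝ)))
    (hSs : ∀ κ u j k, Summable fun p : Site 4 × Site 4 =>
      ∑ g, ∑ f, |blk (S κ u) j k p.1 p.2 g f| * Real.exp (σ * (l1 (p.1 - u) + l1 (p.2 - u))))
    (hSB : ∀ (κ : Fin (3 + 1)) (y' : Fin (3 + 1) → ℤ) (j k : Bool), ∑ b ∈ box (3 + 1) n,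
      (∑' q : Site 4 × Site 4, ∑ g, ∑ f, |blk (S κ ((n : ℤ) • y' + toSite b)) j k q.1 q.2 g f|
        * Real.exp (σ * (l1 (q.1 - ((n : ℤ) • y' + toSite b)) + l1 (q.2 - ((n : ℤ) • y' + toSite b)))))
      ≤ (n : ℝ) ^ (p + 5) * mS j k)
    (μ : Fin (3 + 1)) (y : Fin (3 + 1) → ℤ) (j k : Bool) :
    (Summable fun q : Site 4 × Site 4 => ∑ g, ∑ f,
        |blk (vertexOfK (KInvStep (d := 3) n 0) n S μ y) j k q.1 q.2 g f|
          * Real.exp (σ * (l1 (q.1 - (n : ℤ) • y) + l1 (q.2 - (n : ℤ) • y)))) ∧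
      ∑' q : Site 4 × Site 4, ∑ g, ∑ f,
          |blk (vertexOfK (KInvStep (d := 3) n 0) n S μ y) j k q.1 q.2 g f|
            * Real.exp (σ * (l1 (q.1 - (n : ℤ) • y) + l1 (q.2 - (n : ℤ) • y)))
        ≤ (n : ℝ) ^ p * (4 * ((MG163 4 * periodConst (kappa163 4) 3) * Real.exp (kappa163 4 / 4))
            * Real.exp (kappa163 4 / 4 / 2) * Zl 4 (kappa163 4 / 4 / 8)) * mS j k := by
  have hn0 : (0 : ℝ) < (n : ℝ) := by exact_mod_cast Nat.pos_of_ne_zero (NeZero.ne n)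
  set aa : ℝ := kappa163 4 / 4 / (4 * (n : ℝ)) with haa
  have hκ : 0 < kappa163 4 := kappa163_pos 4
  have haa0 : 0 < aa := by positivity
  have hσ' : σ ≤ aa / 4 := by
    refine hσ.trans (le_of_eq ?_)
    rw [haa]; field_simp; ring
  obtain ⟨hs, hb⟩ := mass_blk_vertexOfK_le_of_blockTotal (KInvStep (d := 3) n 0) n
    (T := fun j k => (n : ℝ) ^ (p + 5) * mS j k) haa0 (colH_K₀_road_weight_nonneg n) hσ0 hσ' μ y
    (fun κ u => abs_colH_K₀_road_le n μ y κ u) hSs hSB j k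
  refine ⟨hs, hb.trans (le_of_eq ?_)⟩
  have e1 : 2 * aa * (n : ℝ) = kappa163 4 / 4 / 2 := by rw [haa]; field_simp; ring
  have e2 : aa * (n : ℝ) / 2 = kappa163 4 / 4 / 8 := by rw [haa]; field_simp; ring
  rw [e1, e2]
  have hn : ((n : ℝ)) ≠ 0 := hn0.ne'
  have epow : ((n : ℝ)) ^ (p + 5) = ((n : ℝ)) ^ p * ((n : ℝ)) ^ 5 := pow_add _ _ _
  rw [epow]
  have hn5 : ((n : ℝ)) ^ 5 ≠ 0 := by positivity
  field_simp

end Single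

/-! ## §4 The PAIR at the straight column: FILE 4 §2 ∕ §3 BY NAME, the power `n⁻¹⁰` displayed -/

section Pair

/-- [folklore] **«K0-TABLE-MASS», ONE BLOCK — THE (M-b) PACKED BI-VERTEX ROW AT THE STRAIGHT COLUMN, POWER DISPLAYED** (UNCONDITIONAL): for a pair pack `S₂` whose `(j, i)`
blocks have per-slot-pair summable plain masses and BLOCK-PAIR totals `Σ_{b,b′ ∈ box 4 n} Σ'|blk (S₂ κ (n•y₁+b) κ′ (n•y₂+b′)) j i| ≤ T·e^{−θ|y₂ − y₁|₁}` (`0 < θ`; `T` = the table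
author's count, every unit included), the `(j, i)` block of `vertex2OfK (KInvStep 3 n 0) n S₂ μ y ν y′` has summable plain mass
`≤ (n^{10})⁻¹·(16·(C₄·e^{κ′})²·e^{2κ′}·Zl 4 (κ′∕8)·Zl 4 (θ∕2))·T·e^{−min (κ′∕8) (θ∕2)·|y′ − y|₁}` — FILE 4 §2 `mass_nested_wsum_le_of_blockPairTotal` (`blk_vertex2OfK` BY NAME) at
«K0-COL-ENV» on both columns (`C_H = (n⁵)⁻¹·C₄·e^{κ′}`, `ρ = κ′∕(4n)`: `ρ·4·n = κ′`, `ρn∕2 = κ′∕8`, `C_H² = (n^{10})⁻¹·(C₄e^{κ′})²`): TWO straight columns pay exactly `n⁻¹⁰`. -/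
theorem mass_blk_vertex2OfK_K₀_le (n : ℕ) [NeZero n] {S₂ : Fin 4 → Site 4 → Fin 4 → Site 4 → MKer 4 (Fib 3)} (j i : Bool) {θ T : ℝ}
    (hθ : 0 < θ)
    (hTs : ∀ κ u κ' u', Summable fun q : Site 4 × Site 4 => ∑ g, ∑ f, |blk (S₂ κ u κ' u') j i q.1 q.2 g f|)
    (hTB : ∀ (κ κ' : Fin 4) (y₁ y₂ : Site 4), ∑ b ∈ box 4 n, ∑ b' ∈ box 4 n,
      (∑' q : Site 4 × Site 4, ∑ g, ∑ f,
        |blk (S₂ κ ((n : ℤ) • y₁ + toSite b) κ' ((n : ℤ) • y₂ + toSite b')) j i q.1 q.2 g f|)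
        ≤ T * Real.exp (-θ * l1 (y₂ - y₁)))
    (μ : Fin 4) (y : Site 4) (ν : Fin 4) (y' : Site 4) :
    (Summable fun q : Site 4 × Site 4 => ∑ g, ∑ f,
        |blk (vertex2OfK (KInvStep (d := 3) n 0) n S₂ μ y ν y') j i q.1 q.2 g f|) ∧
      ∑' q : Site 4 × Site 4, ∑ g, ∑ f,
          |blk (vertex2OfK (KInvStep (d := 3) n 0) n S₂ μ y ν y') j i q.1 q.2 g f|
        ≤ (((n : ℝ)) ^ 10)⁻¹ * (16 * ((MG163 4 * periodConst (kappa163 4) 3) * Real.exp (kappa163 4 / 4)) ^ 2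
            * (Real.exp (kappa163 4 / 4) * Real.exp (kappa163 4 / 4)) * (Zl 4 (kappa163 4 / 4 / 8) * Zl 4 (θ / 2)))
          * T * Real.exp (-(min (kappa163 4 / 4 / 8) (θ / 2)) * l1 (y' - y)) := by
  have hn0 : (0 : ℝ) < (n : ℝ) := by exact_mod_cast Nat.pos_of_ne_zero (NeZero.ne n)
  have hκ : 0 < kappa163 4 := kappa163_pos 4
  set K₀ : ℝ := (MG163 4 * periodConst (kappa163 4) 3) * Real.exp (kappa163 4 / 4) with hK₀
  set CH : ℝ := ((n : ℝ) ^ 5)⁻¹ * K₀ with hCH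
  set aa : ℝ := kappa163 4 / 4 / (4 * (n : ℝ)) with haa
  have haa0 : 0 < aa := by positivity
  have hcol : ∀ ρ' y₀ κ u, |colH (KInvStep (d := 3) n 0) n ρ' y₀ κ u| ≤ CH * Real.exp (-aa * l1 (u - (n : ℤ) • y₀)) :=
    fun ρ' y₀ κ u => by
      have h := abs_colH_K₀_road_le n ρ' y₀ κ u
      rw [hCH, haa]
      exact h
  have hCH0 : 0 ≤ CH := colH_K₀_road_weight_nonneg n
  rw [blk_vertex2OfK]
  have h := mass_nested_wsum_le_of_blockPairTotal (D := 4) (n := n) (ι := Fin 4)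
    (w₁ := fun κ => colH (KInvStep (d := 3) n 0) n μ y κ) (w₂ := fun κ => colH (KInvStep (d := 3) n 0) n ν y' κ)
    (P := fun κ u κ' u' => blk (S₂ κ u κ' u') j i) (T := T) y y' haa0 hθ hCH0 hCH0 (fun κ u => hcol μ y κ u) (fun κ u => hcol ν y' κ u)
    hTs hTB
  refine ⟨h.1, h.2.trans (le_of_eq ?_)⟩
  have e4 : ((4 : ℕ) : ℝ) = 4 := by norm_num
  simp only [Fintype.card_fin, e4]
  -- the constants: `aa·4·n = κ′`, `aa·n∕2 = κ′∕8`, `CH·CH = (n^{10})⁻¹·K₀²`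
  have e1 : aa * (4 : ℝ) * (n : ℝ) = kappa163 4 / 4 := by rw [haa]; field_simp
  have e2 : aa * (n : ℝ) / 2 = kappa163 4 / 4 / 8 := by rw [haa]; field_simp; ring
  rw [e1, e2, hCH]
  have hn5 : ((n : ℝ)) ^ 5 ≠ 0 := by positivity
  have hn10 : ((n : ℝ)) ^ 10 ≠ 0 := by positivity
  have e10 : ((n : ℝ)) ^ 10 = ((n : ℝ)) ^ 5 * ((n : ℝ)) ^ 5 := by rw [← pow_add]
  rw [e10]
  field_simp
  ring

/-- [folklore] **«K0-TABLE-MASS», ALL FOUR BLOCKS** — FILE 4 §4 `mass_blk_vertex2OfK_G₀_le_of_blockPairTotal`'s hypothesis SHAPE with the block-pair totals `≤ T j i·e^{−θ|y₂ − y₁|₁}`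
(the table author's count with every unit included) ⟹ every block of `vertex2OfK (KInvStep 3 n 0) n S₂ μ y ν y′` has summable plain mass
`≤ (n^{10})⁻¹·(16·(C₄·e^{κ′})²·e^{2κ′}·Zl 4 (κ′∕8)·Zl 4 (θ∕2))·T j i·e^{−min (κ′∕8) (θ∕2)·|y′ − y|₁}` (the previous lemma, block by block). -/
theorem mass_blk_vertex2OfK_K₀_le_of_blockPairTotal (n : ℕ) [NeZero n] {S₂ : Fin 4 → Site 4 → Fin 4 → Site 4 → MKer 4 (Fib 3)} {θ : ℝ} {T : Bool → Bool → ℝ}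
    (hθ : 0 < θ)
    (hTs : ∀ κ u κ' u' j i, Summable fun q : Site 4 × Site 4 => ∑ g, ∑ f, |blk (S₂ κ u κ' u') j i q.1 q.2 g f|)
    (hTB : ∀ (κ κ' : Fin 4) (y₁ y₂ : Site 4) (j i : Bool), ∑ b ∈ box 4 n, ∑ b' ∈ box 4 n,
      (∑' q : Site 4 × Site 4, ∑ g, ∑ f,
        |blk (S₂ κ ((n : ℤ) • y₁ + toSite b) κ' ((n : ℤ) • y₂ + toSite b')) j i q.1 q.2 g f|)
        ≤ T j i * Real.exp (-θ * l1 (y₂ - y₁)))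
    (μ : Fin 4) (y : Site 4) (ν : Fin 4) (y' : Site 4) (j i : Bool) :
    (Summable fun q : Site 4 × Site 4 => ∑ g, ∑ f,
        |blk (vertex2OfK (KInvStep (d := 3) n 0) n S₂ μ y ν y') j i q.1 q.2 g f|) ∧
      ∑' q : Site 4 × Site 4, ∑ g, ∑ f,
          |blk (vertex2OfK (KInvStep (d := 3) n 0) n S₂ μ y ν y') j i q.1 q.2 g f|
        ≤ (((n : ℝ)) ^ 10)⁻¹ * (16 * ((MG163 4 * periodConst (kappa163 4) 3) * Real.exp (kappa163 4 / 4)) ^ 2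
            * (Real.exp (kappa163 4 / 4) * Real.exp (kappa163 4 / 4)) * (Zl 4 (kappa163 4 / 4 / 8) * Zl 4 (θ / 2)))
          * T j i * Real.exp (-(min (kappa163 4 / 4 / 8) (θ / 2)) * l1 (y' - y)) :=
  mass_blk_vertex2OfK_K₀_le n j i hθ (fun κ u κ' u' => hTs κ u κ' u' j i) (fun κ κ' y₁ y₂ => hTB κ κ' y₁ y₂ j i) μ y ν y'

/-- [folklore] **THE SAME ROW, THE TABLE's POWER FREE** (ONE block; R-T's reading): block-pair totals `≤ n^{p+10}·m̄W·e^{−θ|y₂ − y₁|₁}` (any `p : ℕ` — the table author's count with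
every unit of the literal included) give the `(j, i)` block of `vertex2OfK (KInvStep 3 n 0) n S₂ μ y ν y′` summable plain mass
`≤ n^p·((16·(C₄·e^{κ′})²·e^{2κ′}·Zl 4 (κ′∕8)·Zl 4 (θ∕2))·m̄W)·e^{−min (κ′∕8) (θ∕2)·|y′ − y|₁}` — the two straight columns pay exactly `n⁻¹⁰`. -/
theorem mass_blk_vertex2OfK_K₀_le_pow (n : ℕ) [NeZero n] (p : ℕ) {S₂ : Fin 4 → Site 4 → Fin 4 → Site 4 → MKer 4 (Fib 3)} (j i : Bool) {θ mW : ℝ}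
    (hθ : 0 < θ)
    (hTs : ∀ κ u κ' u', Summable fun q : Site 4 × Site 4 => ∑ g, ∑ f, |blk (S₂ κ u κ' u') j i q.1 q.2 g f|)
    (hTB : ∀ (κ κ' : Fin 4) (y₁ y₂ : Site 4), ∑ b ∈ box 4 n, ∑ b' ∈ box 4 n,
      (∑' q : Site 4 × Site 4, ∑ g, ∑ f,
        |blk (S₂ κ ((n : ℤ) • y₁ + toSite b) κ' ((n : ℤ) • y₂ + toSite b')) j i q.1 q.2 g f|)
        ≤ (n : ℝ) ^ (p + 10) * mW * Real.exp (-θ * l1 (y₂ - y₁)))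
    (μ : Fin 4) (y : Site 4) (ν : Fin 4) (y' : Site 4) :
    (Summable fun q : Site 4 × Site 4 => ∑ g, ∑ f,
        |blk (vertex2OfK (KInvStep (d := 3) n 0) n S₂ μ y ν y') j i q.1 q.2 g f|) ∧
      ∑' q : Site 4 × Site 4, ∑ g, ∑ f,
          |blk (vertex2OfK (KInvStep (d := 3) n 0) n S₂ μ y ν y') j i q.1 q.2 g f|
        ≤ (n : ℝ) ^ p * ((16 * ((MG163 4 * periodConst (kappa163 4) 3) * Real.exp (kappa163 4 / 4)) ^ 2
            * (Real.exp (kappa163 4 / 4) * Real.exp (kappa163 4 / 4)) * (Zl 4 (kappa163 4 / 4 / 8) * Zl 4 (θ / 2))) * mW)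
          * Real.exp (-(min (kappa163 4 / 4 / 8) (θ / 2)) * l1 (y' - y)) := by
  have hn0 : (0 : ℝ) < (n : ℝ) := by exact_mod_cast Nat.pos_of_ne_zero (NeZero.ne n)
  obtain ⟨hs, hb⟩ := mass_blk_vertex2OfK_K₀_le n j i (T := (n : ℝ) ^ (p + 10) * mW) hθ hTs hTB μ y ν y'
  refine ⟨hs, hb.trans (le_of_eq ?_)⟩
  have hn10 : ((n : ℝ)) ^ 10 ≠ 0 := by positivity
  have epow : ((n : ℝ)) ^ (p + 10) = ((n : ℝ)) ^ p * ((n : ℝ)) ^ 10 := pow_add _ _ _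
  rw [epow]
  field_simp

/-- [folklore] **THE SAME ROW IN FILE 4 ∕ FILE 5's `n⁸·m̄B` CURRENCY** (the currency of `PackedColumnBlockTotalOfPerSlot.hTB_of_hBm` and of g59's `hTB_*_of_hBm` letters; all four
blocks): block-pair totals `≤ n⁸·m̄B j i·e^{−θ|y₂ − y₁|₁}` give every block of `vertex2OfK (KInvStep 3 n 0) n S₂ μ y ν y′` summable plain mass
`≤ (n²)⁻¹·(16·(C₄·e^{κ′})²·e^{2κ′}·Zl 4 (κ′∕8)·Zl 4 (θ∕2))·m̄B j i·e^{−min (κ′∕8) (θ∕2)·|y′ − y|₁}` — TWO powers of `n` below FILE 4 §4's bm-dressed row (power `n⁰`). -/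
theorem mass_blk_vertex2OfK_K₀_le_of_blockPairTotal₈ (n : ℕ) [NeZero n] {S₂ : Fin 4 → Site 4 → Fin 4 → Site 4 → MKer 4 (Fib 3)} {θ : ℝ} {mB : Bool → Bool → ℝ}
    (hθ : 0 < θ)
    (hTs : ∀ κ u κ' u' j i, Summable fun q : Site 4 × Site 4 => ∑ g, ∑ f, |blk (S₂ κ u κ' u') j i q.1 q.2 g f|)
    (hTB : ∀ (κ κ' : Fin 4) (y₁ y₂ : Site 4) (j i : Bool), ∑ b ∈ box 4 n, ∑ b' ∈ box 4 n,
      (∑' q : Site 4 × Site 4, ∑ g, ∑ f,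
        |blk (S₂ κ ((n : ℤ) • y₁ + toSite b) κ' ((n : ℤ) • y₂ + toSite b')) j i q.1 q.2 g f|)
        ≤ (n : ℝ) ^ 8 * mB j i * Real.exp (-θ * l1 (y₂ - y₁)))
    (μ : Fin 4) (y : Site 4) (ν : Fin 4) (y' : Site 4) (j i : Bool) :
    (Summable fun q : Site 4 × Site 4 => ∑ g, ∑ f,
        |blk (vertex2OfK (KInvStep (d := 3) n 0) n S₂ μ y ν y') j i q.1 q.2 g f|) ∧
      ∑' q : Site 4 × Site 4, ∑ g, ∑ f,
          |blk (vertex2OfK (KInvStep (d := 3) n 0) n S₂ μ y ν y') j i q.1 q.2 g f|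
        ≤ (((n : ℝ)) ^ 2)⁻¹ * (16 * ((MG163 4 * periodConst (kappa163 4) 3) * Real.exp (kappa163 4 / 4)) ^ 2
            * (Real.exp (kappa163 4 / 4) * Real.exp (kappa163 4 / 4)) * (Zl 4 (kappa163 4 / 4 / 8) * Zl 4 (θ / 2)))
          * mB j i * Real.exp (-(min (kappa163 4 / 4 / 8) (θ / 2)) * l1 (y' - y)) := by
  have hn0 : (0 : ℝ) < (n : ℝ) := by exact_mod_cast Nat.pos_of_ne_zero (NeZero.ne n)
  obtain ⟨hs, hb⟩ := mass_blk_vertex2OfK_K₀_le n j i (T := (n : ℝ) ^ 8 * mB j i) hθ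
    (fun κ u κ' u' => hTs κ u κ' u' j i) (fun κ κ' y₁ y₂ => hTB κ κ' y₁ y₂ j i) μ y ν y'
  refine ⟨hs, hb.trans (le_of_eq ?_)⟩
  have hn2 : ((n : ℝ)) ^ 2 ≠ 0 := by positivity
  have hn8 : ((n : ℝ)) ^ 8 ≠ 0 := by positivity
  have epow : ((n : ℝ)) ^ 10 = ((n : ℝ)) ^ 8 * ((n : ℝ)) ^ 2 := by rw [← pow_add]
  rw [epow]
  field_simp

end Pair

/-! ## §5 R-T's pair letter, literally: the `ffW` block of `𝒲 n := vertex2OfK (KInvStep 3 n 0) n (S₂ n)` at the coarse origin -/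

section RT

/-- [folklore] **THE `hWs ∕ hWm` SHAPE OF R-T `RestKernelSandwichScaled.exists_rows_RkSand_scaled ∕ exists_row_RkSand_tadpole_unit` FOR THE STRAIGHT-COLUMN PAIR FAMILY**:
for a per-scale pair pack `S₂ n` whose ff blocks have per-slot-pair summable plain masses and block-pair totals `≤ n^{p+10}·m̄W·e^{−θ|y₂ − y₁|₁}` at every scale `n = m + 1`
(the table author's count — NOT supplied here), the family `𝒲 n := vertex2OfK (KInvStep 3 n 0) n (S₂ n)` satisfies, for every `m` and every coarse `z`,
`Summable (q ↦ Σ_{g f} |ffW (𝒲 (m+1)) μ 0 ν z q g f|)` and `Σ'_q Σ_{g f} |ffW (𝒲 (m+1)) μ 0 ν z q g f| ≤ (m+1)^p·(C_{K₀,2}(θ)·m̄W)·e^{−min (κ′∕8) (θ∕2)·|z|₁}`,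
`C_{K₀,2}(θ) := 16·(C₄·e^{κ′})²·e^{2κ′}·Zl 4 (κ′∕8)·Zl 4 (θ∕2)` — at `p = 2` LITERALLY R-T's `hWs`, `hWm` with `mW := C_{K₀,2}(θ)·m̄W`, `κ := min (κ′∕8) (θ∕2)`
(`PackedKernelSplit.ffW_apply`: `ffW W μ y ν y′ = blk (W μ y ν y′) tt tt`; §4 `_pow` at `(j, i) = (tt, tt)`, `y := 0`, `y′ := z`). -/
theorem ffW_vertex2OfK_K₀_rows_pow (p : ℕ) {S₂ : ℕ → Fin 4 → Site 4 → Fin 4 → Site 4 → MKer 4 (Fib 3)} {θ mW : ℝ} (hθ : 0 < θ)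
    (hTs : ∀ (m : ℕ) κ u κ' u', Summable fun q : Site 4 × Site 4 => ∑ g, ∑ f, |blk (S₂ (m + 1) κ u κ' u') true true q.1 q.2 g f|)
    (hTB : ∀ (m : ℕ) (κ κ' : Fin 4) (y₁ y₂ : Site 4), ∑ b ∈ box 4 (m + 1), ∑ b' ∈ box 4 (m + 1),
      (∑' q : Site 4 × Site 4, ∑ g, ∑ f,
        |blk (S₂ (m + 1) κ (((m + 1 : ℕ) : ℤ) • y₁ + toSite b) κ' (((m + 1 : ℕ) : ℤ) • y₂ + toSite b')) true true q.1 q.2 g f|)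
        ≤ ((m + 1 : ℕ) : ℝ) ^ (p + 10) * mW * Real.exp (-θ * l1 (y₂ - y₁)))
    (μ ν : Fin 4) (m : ℕ) (z : Site 4) :
    (Summable fun q : Site 4 × Site 4 => ∑ g, ∑ f,
        |ffW (vertex2OfK (KInvStep (d := 3) (m + 1) 0) (m + 1) (S₂ (m + 1))) μ 0 ν z q.1 q.2 g f|) ∧
      ∑' q : Site 4 × Site 4, ∑ g, ∑ f, |ffW (vertex2OfK (KInvStep (d := 3) (m + 1) 0) (m + 1) (S₂ (m + 1))) μ 0 ν z q.1 q.2 g f|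
        ≤ ((m + 1 : ℕ) : ℝ) ^ p * ((16 * ((MG163 4 * periodConst (kappa163 4) 3) * Real.exp (kappa163 4 / 4)) ^ 2
            * (Real.exp (kappa163 4 / 4) * Real.exp (kappa163 4 / 4)) * (Zl 4 (kappa163 4 / 4 / 8) * Zl 4 (θ / 2))) * mW)
          * Real.exp (-(min (kappa163 4 / 4 / 8) (θ / 2)) * l1 z) := by
  have h := mass_blk_vertex2OfK_K₀_le_pow (m + 1) p (S₂ := S₂ (m + 1)) true true hθ (hTs m) (hTB m) μ 0 ν z
  rw [ffW_apply]
  simpa only [smul_zero, sub_zero] using h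

end RT

end Summit.QuantumFields.BalabanUV.Beta.D1BFx.PackedStraightColumnMass

end
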